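import Summits.Ventures.Crystal3D.Bulk.CapBoxCheck
import Summits.Ventures.Crystal3D.Bulk.CapX2Dense
import HarnessLib

/-!
# Bridge: the tensor-Bernstein check for seat p1's dense X2 polynomials (`CapX2.P3`)

Venture `Crystal3D` (cell `pub-crystal3d`, phase 2; seat typer-bulk). `CapX2.P3 = List (List (List ℚ))` (seat p1,
`CapX2Dense.lean`) has the same layout as this chain's `QT3` (`u` outer, `v`, `t` inner) and the same Horner
semantics; `eval3_eq_capX2_eval3` identifies the two evaluations, so the generic soundness theorem
`nonneg_of_checkPos3` applies verbatim to p1's polynomials for the X2 inequalities (II) (box `[u₀,1]²×[-1,s]`)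
and (III) (box `[-1,s]³`), both with the Gram side condition: `capX2_nonneg_of_checkPos3`.
HONEST FRAMING: bookkeeping [folklore]; no X2 inequality is evaluated here.
-/

open Literature.Geometry.DiscreteGeometry.BachocVallentin

namespace Summit.Ventures.Crystal3D.CapCut.Bern

/-- Lines: `pvF` over `ℚ → ℝ` is the Literature Horner evaluation. [folklore] -/
theorem pvF_rat_eq_upolyEval : ∀ (ln : List ℚ) (t : ℝ), pvF (fun q : ℚ => (q : ℝ)) ln t = upolyEval ln t := by
  intro ln; induction ln with
  | nil => intro t; rfl
  | cons c cs ih => intro t; simp only [pvF, upolyEval, ih]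

/-- Slices: `pvF` semantics = `CapX2.eval2`. [folklore] -/
theorem pvF_eq_capX2_eval2 : ∀ (sl : List (List ℚ)) (v t : ℝ),
    pvF (fun ln => pvF (fun q : ℚ => (q : ℝ)) ln t) sl v = CapX2.eval2 sl v t := by
  intro sl; induction sl with
  | nil => intro v t; rfl
  | cons l p ih =>
    intro v t
    show pvF (fun q : ℚ => (q : ℝ)) l t + v * pvF (fun ln => pvF (fun q : ℚ => (q : ℝ)) ln t) p v = _
    rw [pvF_rat_eq_upolyEval, ih]; rfl

/-- **Same tensors, same values**: `Bern.eval3 = CapX2.eval3`. [folklore] -/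
theorem eval3_eq_capX2_eval3 : ∀ (P : QT3) (u v t : ℝ), eval3 P u v t = CapX2.eval3 P u v t := by
  intro P; induction P with
  | nil => intro u v t; rfl
  | cons q p ih =>
    intro u v t
    have h : eval3 (q :: p) u v t = pvF (fun ln => pvF (fun x : ℚ => (x : ℝ)) ln t) q v + u * eval3 p u v t := rfl
    rw [h, ih, pvF_eq_capX2_eval2]; rfl

/-- **The box check for p1's polynomials**: a `true` run of `checkPos3` on a `CapX2.P3` proves
`CapX2.eval3 P ≥ 0` on the box where the Gram determinant is `≥ 0`. [folklore] -/
theorem capX2_nonneg_of_checkPos3 (P : CapX2.P3) (n : ℕ) (lo0 hi0 lo1 hi1 lo2 hi2 : ℚ) (NB NGB fuel : ℕ)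
    (h : checkPos3 P n lo0 hi0 lo1 hi1 lo2 hi2 NB NGB fuel = true) :
    ∀ u v t : ℝ, (lo0 : ℝ) ≤ u → u ≤ hi0 → (lo1 : ℝ) ≤ v → v ≤ hi1 → (lo2 : ℝ) ≤ t → t ≤ hi2 →
      0 ≤ 1 + 2 * u * v * t - u ^ 2 - v ^ 2 - t ^ 2 → 0 ≤ CapX2.eval3 P u v t := by
  intro u v t hu0 hu1 hv0 hv1 ht0 ht1 hg
  rw [← eval3_eq_capX2_eval3]
  exact nonneg_of_checkPos3 P n lo0 hi0 lo1 hi1 lo2 hi2 NB NGB fuel h u v t hu0 hu1 hv0 hv1 ht0 ht1 hg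

end Summit.Ventures.Crystal3D.CapCut.Bern
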